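import Mathlib
import Summits.Ventures.PercRepro.TriangleCapRowTArith
import Summits.Ventures.PercRepro.TriangleCapRowTMixedArith
import Summits.Ventures.PercRepro.TriangleCapVertexLeaf
import Summits.Ventures.PercRepro.TriangleCapRowJPieces

/-!
# PercRepro — THE ROWS `r = a + j` WITH `a ≤ j + 4`: THE PIECES — the window, the all-off read through the plain star
bound, the sides of an `a`-bipartite `D − z`, and the vertex-bound mixed core with the leaf term (p3, gen 49;
part 203d)

`rowTreg_window`: every degree in `[a, k − a − 1]` gives the one-triangle target for every `a ≥ 5`. `rowTreg_alloff`: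
every neighbour of `z` off the `a`-side of `D − z` — the plain star bound of `D − z` on `(k − 1, a, d + j)` and the
off-side neighbours at `≤ a` give the target once `a ≤ j + 4` (the level-`j` stability of part 202f needs
`s ≥ 4j + 3`, false for `a ≤ j + 1`). `sides_Treg_gen`: `a`-bipartite, or at the target, or a neighbour on each side.
`mixed_vertex_core_T`: the outputs of `mixed_vertex_core` (part 202f) together with THE LEAF READ at `x = t − 1`:
every missing pair at `w₀` then goes to an in-side neighbour of `z` (`w₀` is adjacent to at most one of them), the
leaf term `2 Σ_{u ∼_H w₀} (h(u) − 1)` of part 203a is exactly what the degrees `d_{D−z}(u) = k − 1 − a − h(u)` of those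
neighbours give back in `T`, and `S′ + 2T + s (k − 2 − s) + 2x (s − x) + 2x ≤ m′ (k − 1) + 2t (k − a − 2) + 2a +
2 (s₀ − 1)(a + 1 − t)` follows. Axioms: standard.
-/

namespace PercRepro

namespace TriangleCap

namespace C047

open Finset

variable {V : Type*} [Fintype V] [DecidableEq V]

omit [DecidableEq V] in
/-- **THE WINDOW `[a, k − a − 1]` ON `(k, a, a + j)`:** every degree in `[a, k − a − 1]` gives the one-triangle target
(`a ≥ 5`, `k ≥ 3a + j`). -/
theorem rowTreg_window (D : SimpleGraph V) [DecidableRel D.Adj] (a j : ℕ) (ha : 5 ≤ a)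
    (hk : 3 * a + j ≤ Fintype.card V) (hm : D.edgeFinset.card + (a + j) = a * (Fintype.card V - a))
    (hcap : ∀ v, deg D v + a + 1 ≤ Fintype.card V) (hdeg : ∀ v, a ≤ deg D v) :
    ∑ v, deg D v * deg D v + (a + j) * (Fintype.card V - 1 - (a + j)) +
        (2 * Fintype.card V - 14 + 2 * j * (a - 3)) ≤
      D.edgeFinset.card * Fintype.card V := by
  have hsum : ∑ v, (deg D v * deg D v + a * (Fintype.card V - a - 1)) ≤ ∑ v, (Fintype.card V - 1) * deg D v :=
    sum_le_sum (fun v _ => convex_vertex_window (deg D v) (Fintype.card V) a (hdeg v) (hcap v))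
  rw [sum_add_distrib, sum_const, card_univ, smul_eq_mul, ← mul_sum, sum_deg_eq] at hsum
  obtain ⟨k, hk'⟩ : ∃ k, Fintype.card V = k := ⟨_, rfl⟩
  obtain ⟨S, hS⟩ : ∃ S, ∑ v, deg D v * deg D v = S := ⟨_, rfl⟩
  obtain ⟨m, hmdef⟩ : ∃ m, D.edgeFinset.card = m := ⟨_, rfl⟩
  rw [hk'] at hsum hm hk
  rw [hS, hmdef] at hsum
  rw [hmdef] at hm
  rw [hS, hk', hmdef]
  obtain ⟨q, rfl⟩ : ∃ q, a = q + 5 := ⟨a - 5, by omega⟩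
  obtain ⟨c, rfl⟩ : ∃ c, k = 3 * (q + 5) + j + c := ⟨k - (3 * (q + 5) + j), by omega⟩
  have h1 : q + 5 ≤ 3 * (q + 5) + j + c := by omega
  have h2 : 1 ≤ 3 * (q + 5) + j + c - (q + 5) := by omega
  have h3 : 1 ≤ 3 * (q + 5) + j + c := by omega
  have h4 : q + 5 + j ≤ 3 * (q + 5) + j + c - 1 := by omega
  have h5 : 14 ≤ 2 * (3 * (q + 5) + j + c) := by omega
  have h6 : 3 ≤ q + 5 := by omega
  zify [h1, h2, h3, h4, h5, h6] at hsum hm ⊢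
  nlinarith [hsum, hm, Nat.zero_le (q * c), Nat.zero_le (q * q), Nat.zero_le (j * q), Nat.zero_le (j * j),
    Nat.zero_le (j * c)]

/-- **THE ALL-OFF READ ON `(k, a, a + j)`, `a ≤ j + 4`:** `D − z ⊆ K(A′, A′ᶜ)`, every neighbour of `z` off `A′`, some
neighbour `w₀` ⇒ the one-triangle target (the plain star bound of `D − z`, the off-side neighbours at `≤ a`). -/
theorem rowTreg_alloff (D : SimpleGraph V) [DecidableRel D.Adj] (a j : ℕ) (ha : 5 ≤ a) (haj : a ≤ j + 4)
    (hk : 3 * a + j ≤ Fintype.card V) (hm : D.edgeFinset.card + (a + j) = a * (Fintype.card V - a)) (z : V)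
    (hz : deg D z + 1 ≤ a) (A' : Finset {v : V // v ≠ z}) (hA'card : A'.card = a) (hB : BipSub (del D z) A')
    (hm' : (del D z).edgeFinset.card + (deg D z + j) = a * (Fintype.card {v : V // v ≠ z} - a))
    (hnone : ∀ w : {v : V // v ≠ z}, D.Adj w.1 z → w ∉ A') (w₀ : {v : V // v ≠ z}) (hw₀z : D.Adj w₀.1 z) :
    ∑ v, deg D v * deg D v + (a + j) * (Fintype.card V - 1 - (a + j)) +
        (2 * Fintype.card V - 14 + 2 * j * (a - 3)) ≤
      D.edgeFinset.card * Fintype.card V := by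
  have hcard' := card_del z
  have hedges' := card_edges_del D z
  have hsq := sum_deg_sq_del D z
  obtain ⟨Nz, hNzdef⟩ : ∃ Nz : Finset {v : V // v ≠ z},
      Nz = univ.filter (fun w : {v : V // v ≠ z} => D.Adj w.1 z) := ⟨_, rfl⟩
  have hmemNz : ∀ w : {v : V // v ≠ z}, w ∈ Nz ↔ D.Adj w.1 z := fun w => by
    rw [hNzdef, mem_filter]
    simp only [mem_univ, true_and]
  have hNz : Nz.card = deg D z := by rw [hNzdef]; exact card_nbhd_del D z
  have hz1 : 1 ≤ deg D z := by
    rw [← hNz]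
    exact card_pos.mpr ⟨w₀, (hmemNz w₀).mpr hw₀z⟩
  have hTfilt : ∑ w : {v : V // v ≠ z}, (if D.Adj w.1 z then deg (del D z) w else 0) =
      ∑ w ∈ Nz, deg (del D z) w := by
    rw [hNzdef, sum_filter]
  have hT : ∑ w ∈ Nz, deg (del D z) w ≤ deg D z * a := by
    rw [← hNz, ← smul_eq_mul, ← sum_const]
    apply sum_le_sum
    intro w hw
    have := deg_le_card_of_bipSub (del D z) A' hB w (hnone w ((hmemNz w).mp hw))
    rw [hA'card] at this
    exact this
  have hS' := sum_deg_sq_le_of_bipSub (del D z) A' hB a (deg D z + j) hA'card hm' (by omega)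
  rw [hsq, hTfilt, ← hedges']
  obtain ⟨T, hTdef⟩ : ∃ T, ∑ w ∈ Nz, deg (del D z) w = T := ⟨_, rfl⟩
  obtain ⟨S', hS'def⟩ : ∃ S', ∑ w : {v : V // v ≠ z}, deg (del D z) w * deg (del D z) w = S' := ⟨_, rfl⟩
  obtain ⟨m', hm'def⟩ : ∃ m', (del D z).edgeFinset.card = m' := ⟨_, rfl⟩
  rw [hTdef, hS'def, hm'def]
  rw [hTdef] at hT
  rw [hS'def, hm'def] at hS'
  rw [hm'def] at hm' hedges'
  have hcardV' : Fintype.card {v : V // v ≠ z} = Fintype.card V - 1 := by omega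
  rw [hcardV'] at hS' hm'
  have hmd : m' + deg D z + (a + j) = a * (Fintype.card V - a) := by
    have := below_cell_edges a (a + j) (deg D z + j) (deg D z) (Fintype.card V) D.edgeFinset.card m' (by omega)
      (by omega) hedges' hm
    omega
  exact rowT_alloff_arith a j (deg D z) (Fintype.card V) m' S' T ha haj hz1 hz hk hmd hS' hT

/-- **THE SIDES OF AN `a`-BIPARTITE `D − z` ON `(k, a, a + j)`, `a ≤ j + 4`:** `D` is `a`-bipartite, or at the
one-triangle target, or `z` has a neighbour `w₀` off the side and `w₁` on it, `2 ≤ d(z)`, `T + (k − a − 2) ≤ d(z)(k − a − 2) + a`. -/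
theorem sides_Treg_gen (D : SimpleGraph V) [DecidableRel D.Adj] (a j : ℕ) (ha : 5 ≤ a) (haj : a ≤ j + 4)
    (hk : 3 * a + j ≤ Fintype.card V) (hm : D.edgeFinset.card + (a + j) = a * (Fintype.card V - a)) (z : V)
    (hz : deg D z + 1 ≤ a) (A' : Finset {v : V // v ≠ z}) (hA'card : A'.card = a) (hB : BipSub (del D z) A')
    (hm' : (del D z).edgeFinset.card + (deg D z + j) = a * (Fintype.card {v : V // v ≠ z} - a))
    (hcap : ∀ v, deg D v ≤ (Fintype.card V - a - 2) + 1) :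
    (∃ A : Finset V, A.card = a ∧ BipSub D A) ∨
      (∑ v, deg D v * deg D v + (a + j) * (Fintype.card V - 1 - (a + j)) +
          (2 * Fintype.card V - 14 + 2 * j * (a - 3)) ≤ D.edgeFinset.card * Fintype.card V) ∨
      (2 ≤ deg D z ∧ (∃ w₀ : {v : V // v ≠ z}, w₀ ∉ A' ∧ D.Adj w₀.1 z) ∧
        (∃ w₁ : {v : V // v ≠ z}, w₁ ∈ A' ∧ D.Adj w₁.1 z) ∧
        ∑ w : {v : V // v ≠ z}, (if D.Adj w.1 z then deg (del D z) w else 0) + (Fintype.card V - a - 2) ≤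
          deg D z * (Fintype.card V - a - 2) + a) := by
  by_cases hall : ∀ w : {v : V // v ≠ z}, D.Adj w.1 z → w ∈ A'
  · obtain ⟨B, hBcard, hBsub⟩ := bipSub_lift D z A' hB hall
    exact Or.inl ⟨B, by rw [hBcard, hA'card], hBsub⟩
  by_cases hnone : ∀ w : {v : V // v ≠ z}, D.Adj w.1 z → w ∉ A'
  · right; left
    push Not at hall
    obtain ⟨w₀, hw₀z, _⟩ := hall
    exact rowTreg_alloff D a j ha haj hk hm z hz A' hA'card hB hm' hnone w₀ hw₀z
  · right; right
    push Not at hall hnone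
    obtain ⟨w₀, hw₀z, hw₀A⟩ := hall
    obtain ⟨w₁, hw₁z, hw₁A⟩ := hnone
    have hne : w₀ ≠ w₁ := fun h => hw₀A (h ▸ hw₁A)
    obtain ⟨Nz, hNzdef⟩ : ∃ Nz : Finset {v : V // v ≠ z},
        Nz = univ.filter (fun w : {v : V // v ≠ z} => D.Adj w.1 z) := ⟨_, rfl⟩
    have hmemNz : ∀ w : {v : V // v ≠ z}, w ∈ Nz ↔ D.Adj w.1 z := fun w => by
      rw [hNzdef, mem_filter]
      simp only [mem_univ, true_and]
    have hNz : Nz.card = deg D z := by rw [hNzdef]; exact card_nbhd_del D z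
    refine ⟨?_, ⟨w₀, hw₀A, hw₀z⟩, ⟨w₁, hw₁A, hw₁z⟩, ?_⟩
    · have hsub : ({w₀, w₁} : Finset {v : V // v ≠ z}) ⊆ Nz := by
        intro w hw
        rw [mem_insert, mem_singleton] at hw
        rcases hw with rfl | rfl
        · exact (hmemNz _).mpr hw₀z
        · exact (hmemNz _).mpr hw₁z
      have := card_le_card hsub
      rw [card_pair hne] at this
      omega
    · have hTfilt : ∑ w : {v : V // v ≠ z}, (if D.Adj w.1 z then deg (del D z) w else 0) =
          ∑ w ∈ Nz, deg (del D z) w := by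
        rw [hNzdef, sum_filter]
      rw [hTfilt, ← hNz]
      have hdw₀ : deg (del D z) w₀ ≤ a := by
        have := deg_le_card_of_bipSub (del D z) A' hB w₀ hw₀A
        rw [hA'card] at this
        exact this
      exact sum_le_of_mem_le_gen Nz (fun w => deg (del D z) w) (Fintype.card V - a - 2) a ((hmemNz w₀).mpr hw₀z)
        (fun w hw => by
          have h := deg_del D z w
          rw [if_pos ((hmemNz w).mp hw)] at h
          have := hcap w.1
          omega) hdw₀

/-- **THE VERTEX-BOUND MIXED CORE WITH THE LEAF TERM** (`D − z ⊆ K(A′, A′ᶜ)`, `|A′| = a`, `r′` missing pairs, a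
neighbour `w₀` of `z` off the side and a neighbour `w₁` on it, no vertex at the cap): with `t` in-side and `s₀`
off-side neighbours of `z` and `x` the missing degree of `w₀`: `t ≤ x + 1`, `x ≤ r′`, `x ≤ a`, the vertex bound on
`D − z`, `T ≤ t (k − a − 2) + (a − x) + (s₀ − 1)(a + 1 − t)`, `T ≤ t (k − a − s₀) + (a − x) + (s₀ − 1)(a + 1 − t)`, and
at `x = t − 1` the leaf read `S′ + 2T + r′ (k′ − 1 − r′) + 2x (r′ − x) + 2x ≤ m′ k′ + 2t (k − a − 2) + 2a +
2 (s₀ − 1)(a + 1 − t)`. -/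
theorem mixed_vertex_core_T (D : SimpleGraph V) [DecidableRel D.Adj] (hK : K4mFree D) (a : ℕ)
    (hk : 2 * a + 3 ≤ Fintype.card V) (z : V) (A' : Finset {v : V // v ≠ z}) (hA'card : A'.card = a)
    (hB : BipSub (del D z) A') (r' : ℕ) (hr' : r' + 1 ≤ Fintype.card {v : V // v ≠ z})
    (hm' : (del D z).edgeFinset.card + r' = a * (Fintype.card {v : V // v ≠ z} - a))
    (hcap : ∀ v, deg D v ≤ (Fintype.card V - a - 2) + 1) (w₀ : {v : V // v ≠ z}) (hw₀A : w₀ ∉ A')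
    (hw₀z : D.Adj w₀.1 z) (w₁ : {v : V // v ≠ z}) (hw₁A : w₁ ∈ A') (hw₁z : D.Adj w₁.1 z) :
    ∃ t s₀ x, t + s₀ = deg D z ∧ 1 ≤ t ∧ 1 ≤ s₀ ∧ t ≤ x + 1 ∧ x ≤ r' ∧ x ≤ a ∧
      (∑ w : {v : V // v ≠ z}, deg (del D z) w * deg (del D z) w +
          r' * (Fintype.card {v : V // v ≠ z} - 1 - r') + 2 * ((r' - x) * (x - 1)) ≤
        (del D z).edgeFinset.card * Fintype.card {v : V // v ≠ z}) ∧
      (∑ w : {v : V // v ≠ z}, (if D.Adj w.1 z then deg (del D z) w else 0) ≤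
        t * (Fintype.card V - a - 2) + (a - x) + (s₀ - 1) * (a + 1 - t)) ∧
      (∑ w : {v : V // v ≠ z}, (if D.Adj w.1 z then deg (del D z) w else 0) ≤
        t * (Fintype.card V - a - s₀) + (a - x) + (s₀ - 1) * (a + 1 - t)) ∧
      (x + 1 = t →
        ∑ w : {v : V // v ≠ z}, deg (del D z) w * deg (del D z) w +
            2 * ∑ w : {v : V // v ≠ z}, (if D.Adj w.1 z then deg (del D z) w else 0) +
            r' * (Fintype.card {v : V // v ≠ z} - 1 - r') + (2 * (x * (r' - x)) + 2 * x) ≤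
          (del D z).edgeFinset.card * Fintype.card {v : V // v ≠ z} + 2 * (t * (Fintype.card V - a - 2)) + 2 * a +
            2 * ((s₀ - 1) * (a + 1 - t))) := by
  have hcard' := card_del z
  obtain ⟨Nz, hNzdef⟩ : ∃ Nz : Finset {v : V // v ≠ z},
      Nz = univ.filter (fun w : {v : V // v ≠ z} => D.Adj w.1 z) := ⟨_, rfl⟩
  have hmemNz : ∀ w : {v : V // v ≠ z}, w ∈ Nz ↔ D.Adj w.1 z := fun w => by
    rw [hNzdef, mem_filter]
    simp only [mem_univ, true_and]
  have hNz : Nz.card = deg D z := by rw [hNzdef]; exact card_nbhd_del D z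
  have hTfilt : ∑ w : {v : V // v ≠ z}, (if D.Adj w.1 z then deg (del D z) w else 0) =
      ∑ w ∈ Nz, deg (del D z) w := by
    rw [hNzdef, sum_filter]
  rw [hTfilt]
  have hdegNz : ∀ w ∈ Nz, deg (del D z) w + 1 ≤ Fintype.card V - a - 1 := fun w hw => by
    have h := deg_del D z w
    rw [if_pos ((hmemNz w).mp hw)] at h
    have := hcap w.1
    omega
  obtain ⟨I, hI⟩ : ∃ I : Finset {v : V // v ≠ z}, I = Nz.filter (fun w => w ∈ A') := ⟨_, rfl⟩
  obtain ⟨O, hO⟩ : ∃ O : Finset {v : V // v ≠ z}, O = Nz.filter (fun w => w ∉ A') := ⟨_, rfl⟩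
  have hIO : I.card + O.card = deg D z := by
    rw [hI, hO, card_filter_add_card_filter_not, hNz]
  have hIeq : I = A'.filter (fun w => D.Adj w.1 z) := by
    rw [hI]
    ext w
    rw [mem_filter, mem_filter, hmemNz]
    tauto
  have hOeq : O = A'ᶜ.filter (fun w => D.Adj w.1 z) := by
    rw [hO]
    ext w
    rw [mem_filter, mem_filter, hmemNz, mem_compl]
    tauto
  have hTsplit : ∑ w ∈ Nz, deg (del D z) w = ∑ w ∈ I, deg (del D z) w + ∑ w ∈ O, deg (del D z) w := by
    rw [hI, hO, sum_filter_add_sum_filter_not]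
  have hTI : ∑ w ∈ I, deg (del D z) w ≤ I.card * (Fintype.card V - a - 2) := by
    rw [← smul_eq_mul, ← sum_const]
    apply sum_le_sum
    intro w hw
    have := hdegNz w (mem_of_mem_filter w (hI ▸ hw))
    omega
  have hin : ∀ u ∈ I, deg (del D z) u + O.card ≤ (Fintype.card V - a - 1) + 1 := fun u hu => by
    rw [hI, mem_filter, hmemNz] at hu
    have h := inside_deg_bound D hK z A' hB u hu.2 hu.1
    rw [← hOeq, card_compl, hA'card] at h
    have : Fintype.card {v : V // v ≠ z} - a = Fintype.card V - a - 1 := by omega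
    rw [this] at h
    exact h
  have hTI' : ∑ w ∈ I, deg (del D z) w ≤ I.card * (Fintype.card V - a - O.card) := by
    rw [← smul_eq_mul, ← sum_const]
    apply sum_le_sum
    intro w hw
    have := hin w hw
    omega
  have hoff : ∀ w ∈ O, deg (del D z) w + I.card ≤ a + 1 := fun w hw => by
    rw [hO, mem_filter, hmemNz] at hw
    have h := offside_deg_bound D hK z A' hB w hw.2 hw.1
    rw [← hIeq, hA'card] at h
    exact h
  have hw₀O : w₀ ∈ O := by rw [hO, mem_filter, hmemNz]; exact ⟨hw₀z, hw₀A⟩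
  have hw₁I : w₁ ∈ I := by rw [hI, mem_filter, hmemNz]; exact ⟨hw₁z, hw₁A⟩
  have hO1 : 1 ≤ O.card := card_pos.mpr ⟨w₀, hw₀O⟩
  have hI1 : 1 ≤ I.card := card_pos.mpr ⟨w₁, hw₁I⟩
  -- the missing degree `x` of `w₀`
  have hsum₀ := deg_add_deg_missingGraph (del D z) A' hB w₀
  rw [if_neg hw₀A, hA'card] at hsum₀
  have hxr := deg_le_card_edges' (missingGraph (del D z) A') w₀
  rw [card_edges_missingGraph (del D z) A' hB a r' hA'card hm'] at hxr
  have hTO : ∑ w ∈ O, deg (del D z) w ≤ (a - deg (missingGraph (del D z) A') w₀) + (O.card - 1) * (a + 1 - I.card) := by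
    rw [← add_sum_erase O _ hw₀O]
    have h1 : ∑ w ∈ O.erase w₀, deg (del D z) w ≤ ∑ _w ∈ O.erase w₀, (a + 1 - I.card) :=
      sum_le_sum (fun w hw => by have := hoff w (mem_of_mem_erase hw); omega)
    rw [sum_const, smul_eq_mul, card_erase_of_mem hw₀O] at h1
    omega
  have hS := closed_form_stability_bipSub_vertex (del D z) A' hB a r' hA'card hm' hr' w₀
  refine ⟨I.card, O.card, deg (missingGraph (del D z) A') w₀, hIO, hI1, hO1, ?_, hxr, by omega, hS, ?_, ?_, ?_⟩
  · have := hoff w₀ hw₀O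
    omega
  · rw [hTsplit]
    omega
  · rw [hTsplit]
    omega
  · -- the leaf read at `x = t − 1`
    intro hxt
    obtain ⟨L, hL⟩ : ∃ L : Finset {v : V // v ≠ z},
        L = univ.filter (fun u => (missingGraph (del D z) A').Adj w₀ u) := ⟨_, rfl⟩
    have hmemL : ∀ u, u ∈ L ↔ (missingGraph (del D z) A').Adj w₀ u := fun u => by
      rw [hL, mem_filter]
      simp only [mem_univ, true_and]
    have hLcard : L.card = deg (missingGraph (del D z) A') w₀ := by rw [hL]; rfl
    have hLA : ∀ u ∈ L, u ∈ A' := fun u hu => by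
      rw [hmemL, missingGraph_adj] at hu
      have h := hu.1
      tauto
    -- `w₀` is adjacent in `D − z` to at most one in-side neighbour of `z`
    have hone : (I.filter (fun u => (del D z).Adj w₀ u)).card ≤ 1 := by
      by_contra hcon
      push Not at hcon
      obtain ⟨u₁, hu₁, u₂, hu₂, hne⟩ := one_lt_card.mp hcon
      rw [mem_filter, hI, mem_filter, hmemNz] at hu₁ hu₂
      exact not_adj_both D hK (D.adj_symm hw₀z) (D.adj_symm hu₁.1.1) ((del_adj D z w₀ u₁).mp hu₁.2)
        (fun h => hne (Subtype.ext h)) (D.adj_symm hu₂.1.1) ((del_adj D z w₀ u₂).mp hu₂.2)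
    -- the in-side neighbours not missed by `w₀` are exactly those adjacent to it
    have hIL : I.filter (fun u => u ∉ L) = I.filter (fun u => (del D z).Adj w₀ u) := by
      ext u
      rw [mem_filter, mem_filter, hmemL, missingGraph_adj]
      constructor
      · rintro ⟨hu, hnot⟩
        refine ⟨hu, ?_⟩
        by_contra hadj
        apply hnot
        refine ⟨?_, hadj⟩
        have huA : u ∈ A' := by rw [hI, mem_filter] at hu; exact hu.2
        tauto
      · rintro ⟨hu, hadj⟩
        exact ⟨hu, fun h => h.2 hadj⟩
    have hILcard : (I.filter (fun u => u ∈ L)).card + 1 ≥ I.card := by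
      have h := card_filter_add_card_filter_not (s := I) (fun u => u ∈ L)
      rw [hIL] at h
      omega
    have hLsubI : L ⊆ I := by
      have hsub : I.filter (fun u => u ∈ L) ⊆ L := fun u hu => (mem_filter.mp hu).2
      have hcardeq : (I.filter (fun u => u ∈ L)).card = L.card := by
        have h1 := card_le_card hsub
        rw [hLcard] at h1 ⊢
        omega
      have heq : I.filter (fun u => u ∈ L) = L := eq_of_subset_of_card_le hsub (by rw [hcardeq])
      intro u hu
      rw [← heq] at hu
      exact (mem_filter.mp hu).1
    -- the degrees of the in-side neighbours: exact on `L`, `≤ k − a − 2` off `L`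
    have hdegL : ∀ u ∈ L, deg (del D z) u + deg (missingGraph (del D z) A') u =
        Fintype.card {v : V // v ≠ z} - a := fun u hu => by
      have h := deg_add_deg_missingGraph (del D z) A' hB u
      rw [if_pos (hLA u hu), hA'card] at h
      exact h
    have hdegL1 : ∀ u ∈ L, 1 ≤ deg (missingGraph (del D z) A') u := fun u hu => by
      unfold deg
      apply card_pos.mpr
      refine ⟨w₀, ?_⟩
      rw [mem_filter]
      exact ⟨mem_univ _, (missingGraph (del D z) A').adj_symm ((hmemL u).mp hu)⟩
    have hsplitI : ∑ u ∈ I, deg (del D z) u = ∑ u ∈ L, deg (del D z) u + ∑ u ∈ I.filter (fun u => u ∉ L),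
        deg (del D z) u := by
      have h := sum_filter_add_sum_filter_not I (fun u => u ∈ L) (fun u => deg (del D z) u)
      have heq : I.filter (fun u => u ∈ L) = L := by
        ext u
        rw [mem_filter]
        exact ⟨fun h => h.2, fun h => ⟨hLsubI h, h⟩⟩
      rw [heq] at h
      exact h.symm
    have hsumL : ∑ u ∈ L, deg (del D z) u + ∑ u ∈ L, deg (missingGraph (del D z) A') u =
        L.card * (Fintype.card {v : V // v ≠ z} - a) := by
      rw [← sum_add_distrib, sum_congr rfl hdegL, sum_const, smul_eq_mul]
    have hEL : ∑ u ∈ L, (deg (missingGraph (del D z) A') u - 1) + L.card =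
        ∑ u ∈ L, deg (missingGraph (del D z) A') u := by
      rw [card_eq_sum_ones, ← sum_add_distrib]
      apply sum_congr rfl
      intro u hu
      have := hdegL1 u hu
      omega
    have hoffL : ∑ u ∈ I.filter (fun u => u ∉ L), deg (del D z) u ≤
        (I.filter (fun u => u ∉ L)).card * (Fintype.card V - a - 2) := by
      rw [← smul_eq_mul, ← sum_const]
      apply sum_le_sum
      intro u hu
      have := hdegNz u (mem_of_mem_filter u (hI ▸ (mem_filter.mp hu).1))
      omega
    have hcardIL : (I.filter (fun u => u ∉ L)).card + L.card = I.card := by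
      have h := card_filter_add_card_filter_not (s := I) (fun u => u ∈ L)
      have heq : I.filter (fun u => u ∈ L) = L := by
        ext u
        rw [mem_filter]
        exact ⟨fun h => h.2, fun h => ⟨hLsubI h, h⟩⟩
      rw [heq] at h
      omega
    have hleaf := closed_form_stability_bipSub_leaf (del D z) A' hB a r' hA'card hm' hr' w₀
    rw [← hL] at hleaf
    rw [hTsplit]
    have hk' : Fintype.card {v : V // v ≠ z} - a = (Fintype.card V - a - 2) + 1 := by omega
    rw [hk'] at hsumL
    have hxa : deg (missingGraph (del D z) A') w₀ ≤ a := by omega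
    rw [hLcard] at hsumL hEL hcardIL
    rw [← hxt] at hTO ⊢
    generalize hSg : ∑ w : {v : V // v ≠ z}, deg (del D z) w * deg (del D z) w = Sg at hleaf ⊢
    generalize hx : deg (missingGraph (del D z) A') w₀ = x at hleaf hxt hsumL hEL hcardIL hxa hTO ⊢
    generalize hELg : ∑ u ∈ L, (deg (missingGraph (del D z) A') u - 1) = EL at hleaf hEL
    generalize hDL : ∑ u ∈ L, deg (del D z) u = DL at hsumL hsplitI
    generalize hHL : ∑ u ∈ L, deg (missingGraph (del D z) A') u = HL at hsumL hEL
    generalize hoffg : ∑ u ∈ I.filter (fun u => u ∉ L), deg (del D z) u = OFF at hsplitI hoffL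
    generalize hcg : (I.filter (fun u => u ∉ L)).card = c at hoffL hcardIL
    generalize hTOg : ∑ w ∈ O, deg (del D z) w = TO at hTO ⊢
    generalize hTIg : ∑ w ∈ I, deg (del D z) w = TI at hsplitI ⊢
    generalize hK2 : Fintype.card V - a - 2 = K2 at hoffL hsumL ⊢
    generalize hAX : a - x = AX at hTO ⊢
    generalize hOO : (O.card - 1) * (a + 1 - (x + 1)) = OO at hTO ⊢
    have hc : c = 1 := by omega
    subst hc
    have hax : AX + x = a := by omega
    linarith [hleaf, hsumL, hEL, hoffL, hcardIL, hTO, hsplitI, hax]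

end C047

end TriangleCap

end PercRepro
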